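import Mathlib
import Summits.Ventures.HodgeRepro2.T5FiniteZerosUnion
import Summits.Ventures.HodgeRepro2.T5LambdaInvariant
import Summits.Ventures.HodgeRepro2.T5AmiceConvolution

/-!
# T5LambdaUnion — S7's count with the λ-invariants named, and `μ, λ` of a convolution

Cell pub-hodge-repro2, Tier 5 support (seat p7; route/T5-CHECK-G-p7.md §3 S5 / S7). Two complements
to T5LambdaInvariant (`#{ν : ∫ν dm = 0} ≤ λ(m)`) on the model `R = ℤ_p`:

* `ncard_biUnion_zeroSet_le_sum_lambda`: S7's «|⋃_i Z_i| ≤ Σ_i deg P_i» with the degrees NAMED —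
  `#(⋃_{i ∈ I} Z_i) ≤ Σ_{i ∈ I} λ(m_i)` for finitely many bounded `m_i ≠ 0` (T5FiniteZerosUnion's union
  bound + T5LambdaInvariant); `exists_forall_map_ne_zero_of_lt`: among any `Σ λ(m_i) + 1` distinct
  continuous characters one is killed by none of the `m_i`;
* the μ- and λ-invariants are ADDITIVE under convolution (T5AmiceConvolution; `f_{m₁ * m₂} = f_{m₁} f_{m₂}`):
  `mu_conv`: `μ(m₁ * m₂) = μ(m₁) + μ(m₂)` and `lambda_conv`: `λ(m₁ * m₂) = λ(m₁) + λ(m₂)` for bounded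
  `m₁, m₂ ≠ 0` — the classical additivity of the Iwasawa invariants (the reductions `g_i mod p` multiply in
  the domain `𝔽_p[[T]]`, whose `order` is additive: Mathlib's `PowerSeries.order_mul`); in particular
  `conv_ne_zero`: the convolution of non-zero bounded measures is non-zero («`ℤ_p[[Γ]]` is a domain»).

Mathlib + own T5FiniteZerosUnion, T5LambdaInvariant, T5AmiceConvolution (and their imports) only.
-/

namespace Summit.Ventures.HodgeRepro2.T5LambdaUnion

open PadicInt Filter Topology
open Summit.Ventures.HodgeRepro2
open Summit.Ventures.HodgeRepro2.T5AmiceTransform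
open Summit.Ventures.HodgeRepro2.T5MuInvariantPadic
open Summit.Ventures.HodgeRepro2.T5MuInvariantAmice
open Summit.Ventures.HodgeRepro2.T5LambdaInvariant
open Summit.Ventures.HodgeRepro2.T5FiniteZerosUnion
open Summit.Ventures.HodgeRepro2.T5AmiceConvolution

variable {p : ℕ} [hp : Fact p.Prime]

/-! ### S7 with the λ-invariants named -/

section Union

variable {ι : Type*}

/-- S7's COUNT with the degrees named: `#(⋃_{i ∈ I} Z_i) ≤ Σ_{i ∈ I} λ(m_i)` for finitely many bounded
`m_i ≠ 0` on `C(ℤ_p, ℤ_p)`. -/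
theorem ncard_biUnion_zeroSet_le_sum_lambda (I : Finset ι) (m : ι → (C(ℤ_[p], ℤ_[p]) →ₗ[ℤ_[p]] ℤ_[p]))
    (C : ι → ℝ) (hC : ∀ i ∈ I, 0 ≤ C i) (hb : ∀ i ∈ I, ∀ φ, ‖m i φ‖ ≤ C i * ‖φ‖)
    (hne : ∀ i ∈ I, m i ≠ 0) :
    (⋃ i ∈ I, zeroSet (m i)).ncard ≤ ∑ i ∈ I, lambda (m i) :=
  calc (⋃ i ∈ I, zeroSet (m i)).ncard ≤ ∑ i ∈ I, (zeroSet (m i)).ncard :=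
        ncard_biUnion_le_sum I fun i => zeroSet (m i)
    _ ≤ ∑ i ∈ I, lambda (m i) :=
        Finset.sum_le_sum fun i hi => ncard_zeroSet_le_lambda (m i) (hC i hi) (hb i hi) (hne i hi)

/-- Pigeonhole form of S7: any finite set `S` of continuous characters with `#S > Σ_{i ∈ I} λ(m_i)` contains
a character killed by NONE of the `m_i` («choose ν outside ⋃ Z_i»). -/
theorem exists_forall_map_ne_zero_of_lt (I : Finset ι) (m : ι → (C(ℤ_[p], ℤ_[p]) →ₗ[ℤ_[p]] ℤ_[p]))
    (C : ι → ℝ) (hC : ∀ i ∈ I, 0 ≤ C i) (hb : ∀ i ∈ I, ∀ φ, ‖m i φ‖ ≤ C i * ‖φ‖)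
    (hne : ∀ i ∈ I, m i ≠ 0) (S : Finset {κ : AddChar ℤ_[p] ℤ_[p] // Continuous κ})
    (hS : ∑ i ∈ I, lambda (m i) < S.card) :
    ∃ κ ∈ S, ∀ i ∈ I, m i ⟨κ.1, κ.2⟩ ≠ 0 := by
  by_contra h
  have h' : ∀ κ ∈ S, ∃ i ∈ I, m i ⟨κ.1, κ.2⟩ = 0 := fun κ hκ => by
    by_contra h2
    exact h ⟨κ, hκ, fun i hi h0 => h2 ⟨i, hi, h0⟩⟩
  have hsub : (↑S : Set {κ : AddChar ℤ_[p] ℤ_[p] // Continuous κ}) ⊆ ⋃ i ∈ I, zeroSet (m i) := by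
    intro κ hκ
    obtain ⟨i, hi, h0⟩ := h' κ (Finset.mem_coe.mp hκ)
    exact Set.mem_biUnion hi h0
  have hfin : (⋃ i ∈ I, zeroSet (m i)).Finite :=
    finite_biUnion_zeroSet I m (fun i hi => continuous_of_bound (m i) (C i) (hb i hi)) hne
  have h1 : S.card ≤ (⋃ i ∈ I, zeroSet (m i)).ncard := by
    rw [← Set.ncard_coe_finset S]
    exact Set.ncard_le_ncard hsub hfin
  have h2 := ncard_biUnion_zeroSet_le_sum_lambda I m C hC hb hne
  omega

end Union

/-! ### μ and λ of a convolution -/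

section Convolution

variable (m₁ m₂ : C(ℤ_[p], ℤ_[p]) →ₗ[ℤ_[p]] ℤ_[p]) {C₁ C₂ : ℝ}

/-- `f_{m₁ * m₂} = f_{m₁} f_{m₂}` on `ℤ_p` (restated from T5AmiceConvolution with the continuity of `m₂`
derived from its bound). -/
theorem amice_conv' (hb₂ : ∀ φ, ‖m₂ φ‖ ≤ C₂ * ‖φ‖) :
    amice (conv m₁ m₂ (continuous_of_bound m₂ C₂ hb₂)) = amice m₁ * amice m₂ :=
  amice_conv m₁ m₂ _

/-- The reduction mod `p` of the normalised series of a convolution is the product of the reductions. -/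
theorem exists_normalised_conv (hC₁ : 0 ≤ C₁) (hC₂ : 0 ≤ C₂) (hb₁ : ∀ φ, ‖m₁ φ‖ ≤ C₁ * ‖φ‖)
    (hb₂ : ∀ φ, ‖m₂ φ‖ ≤ C₂ * ‖φ‖) (k₁ k₂ : ℕ) (hk₁ : mu p m₁ = k₁) (hk₂ : mu p m₂ = k₂) :
    ∃ g₁ g₂ : PowerSeries ℤ_[p],
      amice m₁ = (p : ℤ_[p]) ^ k₁ • g₁ ∧ amice m₂ = (p : ℤ_[p]) ^ k₂ • g₂ ∧
      g₁.map (IsLocalRing.residue ℤ_[p]) ≠ 0 ∧ g₂.map (IsLocalRing.residue ℤ_[p]) ≠ 0 ∧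
      amice (conv m₁ m₂ (continuous_of_bound m₂ C₂ hb₂)) = (p : ℤ_[p]) ^ (k₁ + k₂) • (g₁ * g₂) ∧
      (g₁ * g₂).map (IsLocalRing.residue ℤ_[p]) ≠ 0 := by
  obtain ⟨g₁, hg₁, -, n₁, hn₁⟩ := exists_amice_eq_pow_smul m₁ hC₁ hb₁ k₁ hk₁
  obtain ⟨g₂, hg₂, -, n₂, hn₂⟩ := exists_amice_eq_pow_smul m₂ hC₂ hb₂ k₂ hk₂
  have hr₁ : g₁.map (IsLocalRing.residue ℤ_[p]) ≠ 0 :=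
    T5FiniteZeros.map_residue_ne_zero_of_isUnit_coeff hn₁
  have hr₂ : g₂.map (IsLocalRing.residue ℤ_[p]) ≠ 0 :=
    T5FiniteZeros.map_residue_ne_zero_of_isUnit_coeff hn₂
  refine ⟨g₁, g₂, hg₁, hg₂, hr₁, hr₂, ?_, ?_⟩
  · rw [amice_conv' m₁ m₂ hb₂, hg₁, hg₂, smul_mul_smul_comm, ← pow_add]
  · rw [map_mul]
    exact mul_ne_zero hr₁ hr₂

/-- `μ(f) = k` for `f = p^k • g` with `g mod p ≠ 0` (the normalised form determines `μ`), read on a measure: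
if `f_m = p^k • g` with `g mod p ≠ 0` then `μ(m) = k`. -/
theorem mu_eq_of_amice_eq_pow_smul (m : C(ℤ_[p], ℤ_[p]) →ₗ[ℤ_[p]] ℤ_[p]) {C : ℝ} (hC : 0 ≤ C)
    (hb : ∀ φ, ‖m φ‖ ≤ C * ‖φ‖) (k : ℕ) (g : PowerSeries ℤ_[p]) (hg : amice m = (p : ℤ_[p]) ^ k • g)
    (hr : g.map (IsLocalRing.residue ℤ_[p]) ≠ 0) : mu p m = k := by
  have hcoeff : ∀ n, vp p (PowerSeries.coeff n (amice m)) = k + vp p (PowerSeries.coeff n g) := by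
    intro n
    rw [hg, PowerSeries.coeff_smul, smul_eq_mul, vp_pow_mul]
  rw [mu_eq_iInf_vp_coeff m hC hb]
  apply le_antisymm
  · -- some coefficient of `g` is a unit
    have hord := PowerSeries.coeff_order hr
    rw [PowerSeries.coeff_map, Ne, IsLocalRing.residue_eq_zero_iff, IsLocalRing.notMem_maximalIdeal,
      ← vp_eq_zero_iff_isUnit] at hord
    refine (iInf_le _ (g.map (IsLocalRing.residue ℤ_[p])).order.toNat).trans ?_
    rw [hcoeff, hord, add_zero]
  · exact le_iInf fun n => by rw [hcoeff]; exact le_self_add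

/-- ADDITIVITY OF μ: `μ(m₁ * m₂) = μ(m₁) + μ(m₂)` for bounded `m₁, m₂ ≠ 0` on `ℤ_p`. -/
theorem mu_conv (hC₁ : 0 ≤ C₁) (hC₂ : 0 ≤ C₂) (hb₁ : ∀ φ, ‖m₁ φ‖ ≤ C₁ * ‖φ‖)
    (hb₂ : ∀ φ, ‖m₂ φ‖ ≤ C₂ * ‖φ‖) (hne₁ : m₁ ≠ 0) (hne₂ : m₂ ≠ 0) :
    mu p (conv m₁ m₂ (continuous_of_bound m₂ C₂ hb₂)) = mu p m₁ + mu p m₂ := by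
  have ht₁ : mu p m₁ ≠ ⊤ := by rw [Ne, mu_eq_top_iff_eq_zero p m₁ hC₁ hb₁]; exact hne₁
  have ht₂ : mu p m₂ ≠ ⊤ := by rw [Ne, mu_eq_top_iff_eq_zero p m₂ hC₂ hb₂]; exact hne₂
  obtain ⟨k₁, hk₁⟩ := ENat.ne_top_iff_exists.mp ht₁
  obtain ⟨k₂, hk₂⟩ := ENat.ne_top_iff_exists.mp ht₂
  obtain ⟨g₁, g₂, -, -, -, -, hconv, hr⟩ :=
    exists_normalised_conv m₁ m₂ hC₁ hC₂ hb₁ hb₂ k₁ k₂ hk₁.symm hk₂.symm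
  rw [mu_eq_of_amice_eq_pow_smul _ (mul_nonneg hC₁ hC₂)
    (conv_bound m₁ m₂ _ hC₁ hC₂ hb₁ hb₂) (k₁ + k₂) (g₁ * g₂) hconv hr, ← hk₁, ← hk₂]
  push_cast
  rfl

/-- The convolution of non-zero bounded measures is non-zero («`ℤ_p[[Γ_𝔭]]` is a domain»). -/
theorem conv_ne_zero (hC₁ : 0 ≤ C₁) (hC₂ : 0 ≤ C₂) (hb₁ : ∀ φ, ‖m₁ φ‖ ≤ C₁ * ‖φ‖)
    (hb₂ : ∀ φ, ‖m₂ φ‖ ≤ C₂ * ‖φ‖) (hne₁ : m₁ ≠ 0) (hne₂ : m₂ ≠ 0) :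
    conv m₁ m₂ (continuous_of_bound m₂ C₂ hb₂) ≠ 0 := by
  rw [Ne, ← mu_eq_top_iff_eq_zero p _ (mul_nonneg hC₁ hC₂) (conv_bound m₁ m₂ _ hC₁ hC₂ hb₁ hb₂),
    mu_conv m₁ m₂ hC₁ hC₂ hb₁ hb₂ hne₁ hne₂]
  have ht₁ : mu p m₁ ≠ ⊤ := by rw [Ne, mu_eq_top_iff_eq_zero p m₁ hC₁ hb₁]; exact hne₁
  have ht₂ : mu p m₂ ≠ ⊤ := by rw [Ne, mu_eq_top_iff_eq_zero p m₂ hC₂ hb₂]; exact hne₂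
  exact WithTop.add_ne_top.mpr ⟨ht₁, ht₂⟩

/-- `λ(m) = order (g mod p)` for the normalised `f_m = p^{μ} • g` (restated from T5LambdaInvariant in the
direction used below). -/
theorem lambda_eq_toNat_order (m : C(ℤ_[p], ℤ_[p]) →ₗ[ℤ_[p]] ℤ_[p]) {C : ℝ} (hC : 0 ≤ C)
    (hb : ∀ φ, ‖m φ‖ ≤ C * ‖φ‖) (hne : m ≠ 0) (k : ℕ) (hk : mu p m = k) (g : PowerSeries ℤ_[p])
    (hg : amice m = (p : ℤ_[p]) ^ k • g) :
    lambda m = (g.map (IsLocalRing.residue ℤ_[p])).order.toNat := by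
  rw [order_map_residue_eq_lambda m hC hb hne k hk g hg]
  rfl

/-- ADDITIVITY OF λ: `λ(m₁ * m₂) = λ(m₁) + λ(m₂)` for bounded `m₁, m₂ ≠ 0` on `ℤ_p` (`𝔽_p[[T]]` is a domain:
Mathlib's `PowerSeries.order_mul`). -/
theorem lambda_conv (hC₁ : 0 ≤ C₁) (hC₂ : 0 ≤ C₂) (hb₁ : ∀ φ, ‖m₁ φ‖ ≤ C₁ * ‖φ‖)
    (hb₂ : ∀ φ, ‖m₂ φ‖ ≤ C₂ * ‖φ‖) (hne₁ : m₁ ≠ 0) (hne₂ : m₂ ≠ 0) :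
    lambda (conv m₁ m₂ (continuous_of_bound m₂ C₂ hb₂)) = lambda m₁ + lambda m₂ := by
  have ht₁ : mu p m₁ ≠ ⊤ := by rw [Ne, mu_eq_top_iff_eq_zero p m₁ hC₁ hb₁]; exact hne₁
  have ht₂ : mu p m₂ ≠ ⊤ := by rw [Ne, mu_eq_top_iff_eq_zero p m₂ hC₂ hb₂]; exact hne₂
  obtain ⟨k₁, hk₁⟩ := ENat.ne_top_iff_exists.mp ht₁
  obtain ⟨k₂, hk₂⟩ := ENat.ne_top_iff_exists.mp ht₂
  obtain ⟨g₁, g₂, hg₁, hg₂, hr₁, hr₂, hconv, hr⟩ :=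
    exists_normalised_conv m₁ m₂ hC₁ hC₂ hb₁ hb₂ k₁ k₂ hk₁.symm hk₂.symm
  have hbc := conv_bound m₁ m₂ (continuous_of_bound m₂ C₂ hb₂) hC₁ hC₂ hb₁ hb₂
  have hne := conv_ne_zero m₁ m₂ hC₁ hC₂ hb₁ hb₂ hne₁ hne₂
  have hmu : mu p (conv m₁ m₂ (continuous_of_bound m₂ C₂ hb₂)) = ((k₁ + k₂ : ℕ) : ℕ∞) :=
    mu_eq_of_amice_eq_pow_smul _ (mul_nonneg hC₁ hC₂) hbc (k₁ + k₂) (g₁ * g₂) hconv hr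
  rw [lambda_eq_toNat_order _ (mul_nonneg hC₁ hC₂) hbc hne (k₁ + k₂) hmu (g₁ * g₂) hconv,
    lambda_eq_toNat_order m₁ hC₁ hb₁ hne₁ k₁ hk₁.symm g₁ hg₁,
    lambda_eq_toNat_order m₂ hC₂ hb₂ hne₂ k₂ hk₂.symm g₂ hg₂,
    map_mul, PowerSeries.order_mul]
  have h₁ := PowerSeries.order_finite_iff_ne_zero.mpr hr₁
  have h₂ := PowerSeries.order_finite_iff_ne_zero.mpr hr₂
  exact ENat.toNat_add h₁.ne h₂.ne

end Convolution

end Summit.Ventures.HodgeRepro2.T5LambdaUnion
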